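import Literature.AlgebraicGeometry.Motives.HodgeThetaSubalgebraUnitarySixSevenCoreAll
import HarnessLib

/-!
# The `Θ`-subalgebra theorem for unitary multiplicities `(8, b)`: the rank-eight raising lemma for every odd `b ≥ 11`
# prime to `3`, and the core for `b ∈ {1, 3, 5, 7, 11, 13, 19}` — complex–Hermitian, classification-free
# (Ribet 1983 Thm. 3, Lie step; `19 = 8 + 11`)

Family `hodge`, layer `Literature/AlgebraicGeometry/Motives` (pure linear algebra over `ℂ`; no geometry). Research
context: cell `pub-hodge-ring2` (HONEST FRAMING: research route conditional on HC_CM; not a corollary; Q11.4-sentence-2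
already refuted in dim ≥ 3), Literature lane gen 84, programme R68. UNCONDITIONAL; theorems only, no definition, no
named fact (D-0026), no `sorry`.

THE SETTING is that of the tree's unitary cores (`HodgeThetaSubalgebraUnitaryTwoOddCore`, `…FiveCoreAll`,
`…SixSevenCoreAll`): `𝔊 ⊆ End_ℂ(W)` bracket-closed and irreducible, an involution `Θ ∈ 𝔊` with eigenspaces `P`, `Q`,
a Hermitian pairing `s` (here `ℂ`-homogeneous in the first slot, as for the Hodge–Riemann form `i·ω(x, ȳ)`) with
`P ⊥ Q`, definite on `P` and on `Q`, for which `𝔊` is adjoint-closed.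

* §1 **`UnitaryEight.exists_raise_onto_eight_of_smul`** — `dim P = 8`, `dim Q ≥ 9` odd and prime to `3` ⟹ a raising
  operator of `𝔊` maps onto `P`. Ranks `2, 4, 6 → +1` by the Φ-route (`UnitaryRaisingRank.exists_raise_rank_gt_of_two_le`)
  with the Levi cores `(2 | odd)`, `(4 | odd)`, `(6 | b − 6)` (`b − 6` odd and prime to `3`: `UnitarySix.eq_top_of_smul`);
  ranks `3, 5 → +1` by the Ψ-core route (`…_of_psi_core`) with the cores `(5 | 3)`, `(3 | 5)`; rank `7 → 8` by the
  triple route (`…_of_finrank_eq_succ_of_smul`: the rank identity `m (8 − ρ) = 7 ρ`, `m = b − 7`, forces `b ∈ {8, 14, 28}`,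
  all even).
* §2 **`UnitaryEight.eq_top_of_smul`** — the `(8 | b)` core for `b` odd, `b ≤ 13`, `b ≠ 9` (bases `b = 1, 3, 5, 7` by the
  tree's `(1 | ·)`, `(3 | ·)`, `(5 | ·)`, `(7 | ·)` cores mirrored; `b = 11, 13` by one Euclid step
  `UnitaryCoprimeStep.eq_top_of_onto_of_core` onto `(8 | 3)`, `(8 | 5)`), **`UnitaryEight.eq_top_of_smul_nineteen`** —
  `(8 | 19)` (one Euclid step onto `(8 | 11)`), and the mirrors `eq_top_of_smul'`, `eq_top_of_smul_nineteen'`.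

WHAT IS NOT COVERED, AND WHY (honest scope). `gcd(8, b) = 1` is `b` odd; the Euclid descent `b → b − 8` of
`UnitaryCoprimeStep` and the rank-`6` step of §1 both need `3 ∤` the current `dim Q`: at a raising operator of maximal
rank `r = 6` the two Levi instances have types `(6 | b − 6)` and `(2 | 6)`, and NEITHER is a coprime pair when `3 ∣ b`
(the `(2 | 6)` statement is false: `𝔰𝔩₂ ⊗ 𝔰𝔩₄` on `ℂ² ⊗ (ℂ¹ ⊕ ℂ³)`). So `(8 | 9)`, `(8 | 15)`, `(8 | 17)` (`17 − 8 = 9`),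
`(8 | 21)`, … are NOT reached by the present rank-raising method; in general the method stalls exactly at ranks `r`
with `gcd(r, dim Q) > 1` and `gcd(r, dim P) > 1` (first instance `r = 6`). Ribet's printed proof covers all coprime
pairs via the classification of minuscule representations [Ribet1983, proof of Thm. 3]; that input is not in Mathlib.

## References
* [Ribet1983] K. A. Ribet, *Hodge classes on certain types of abelian varieties*, Amer. J. Math. 105 (1983), Thm. 3
  (= [Gordon1997, Thm. 6.3 (3)], held `paper:arxiv-alg-geom_9709030` pp. 18–19).
* [Deligne1982HodgeCycles] P. Deligne, *Hodge cycles on abelian varieties*, LNM 900 (1982), I §3 Prop. 3.4, 3.6.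
* [GoodmanWallachGTM255] R. Goodman, N. R. Wallach, GTM 255 (2009), §4.1.1, §3.3.2.
-/

noncomputable section

namespace Literature.AlgebraicGeometry.Motives

namespace HodgeStructure

/-! ### §1 The rank-eight raising lemma -/

section RankEight

universe u

variable {W : Type u} [AddCommGroup W] [Module ℂ W]

/-- **The rank-eight raising lemma** (`dim P = 8`, `dim Q ≥ 9` odd and prime to `3`; the Hermitian form
`ℂ`-homogeneous in the first slot): ranks `2, 4, 6 → +1` by the Φ-route with the cores `(2 | odd)`, `(4 | odd)`,
`(6 | b − 6)`, ranks `3, 5 → +1` by the Ψ-core route with the cores `(5 | 3)`, `(3 | 5)`, rank `7 → 8` by the triple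
route. [cite: Ribet1983, Thm. 3] [cite: Gordon1997, Thm. 6.3 (3)] [cite: Deligne1982HodgeCycles, I §3 Prop. 3.6] -/
theorem UnitaryEight.exists_raise_onto_eight_of_smul [FiniteDimensional ℂ W] {𝔊 : Submodule ℂ (Module.End ℂ W)}
    (hbr : ∀ Y ∈ 𝔊, ∀ Z ∈ 𝔊, Y * Z - Z * Y ∈ 𝔊)
    (hirr : ∀ U : Submodule ℂ W, (∀ A ∈ 𝔊, ∀ u ∈ U, A u ∈ U) → U = ⊥ ∨ U = ⊤)
    {Θ : Module.End ℂ W} (hΘ : Θ ∈ 𝔊) (hΘΘ : Θ * Θ = 1)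
    {P Q : Submodule ℂ W} (hP : ∀ x, x ∈ P ↔ Θ x = x) (hQ : ∀ x, x ∈ Q ↔ Θ x = -x)
    (hP8 : Module.finrank ℂ P = 8) (hQ9 : 9 ≤ Module.finrank ℂ Q) (hQodd : Odd (Module.finrank ℂ Q))
    (hQ3 : ¬ 3 ∣ Module.finrank ℂ Q)
    {s : W → W → ℂ} (hadd : ∀ x y z, s (x + y) z = s x z + s y z)
    (hsmul : ∀ (c : ℂ) (x y : W), s (c • x) y = c * s x y) (hsymm : ∀ x y, s y x = starRingEnd ℂ (s x y))
    (hPQ : ∀ p ∈ P, ∀ q ∈ Q, s p q = 0) (hdefP : ∀ p ∈ P, s p p = 0 → p = 0) (hdefQ : ∀ q ∈ Q, s q q = 0 → q = 0)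
    (hadj : ∀ X ∈ 𝔊, ∃ Y ∈ 𝔊, ∀ x y, s (X x) y = s x (Y y)) :
    ∃ B ∈ 𝔊, Θ * B = B ∧ B * Θ = -B ∧ ∀ p ∈ P, ∃ w, B w = p := by
  classical
  obtain ⟨k, hk⟩ := hQodd
  have hraiseval : ∀ Z : Module.End ℂ W, Θ * Z = Z → ∀ w, Z w ∈ P := fun Z hΘZ w =>
    (hP _).2 (by rw [← Module.End.mul_apply, hΘZ])
  have hle : ∀ B' : Module.End ℂ W, Θ * B' = B' → Module.finrank ℂ (LinearMap.range B') ≤ 8 := fun B' h => by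
    rw [← hP8]
    exact Submodule.finrank_mono (by rintro _ ⟨w, rfl⟩; exact hraiseval B' h w)
  have honto : ∀ B' : Module.End ℂ W, Θ * B' = B' → 8 ≤ Module.finrank ℂ (LinearMap.range B') →
      ∀ p ∈ P, ∃ w, B' w = p := by
    intro B' hΘB' h8 p hp
    have hle' : LinearMap.range B' ≤ P := by rintro _ ⟨w, rfl⟩; exact hraiseval B' hΘB' w
    have heq : LinearMap.range B' = P := Submodule.eq_of_le_of_finrank_le hle' (by rw [hP8]; exact h8)
    have hp' : p ∈ LinearMap.range B' := heq ▸ hp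
    exact hp'
  have hup : ∀ B' ∈ 𝔊, Θ * B' = B' → B' * Θ = -B' →
      2 ≤ Module.finrank ℂ (LinearMap.range B') → Module.finrank ℂ (LinearMap.range B') ≤ 7 →
      ∃ B'' ∈ 𝔊, Θ * B'' = B'' ∧ B'' * Θ = -B'' ∧
        Module.finrank ℂ (LinearMap.range B') < Module.finrank ℂ (LinearMap.range B'') := by
    intro B' hB' hΘB' hB'Θ h2 h7
    by_cases hr7 : Module.finrank ℂ (LinearMap.range B') = 7
    · -- triple route: `m (8 − ρ) = 7 ρ` forces `dim Q ∈ {8, 14, 28}`, all even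
      refine UnitaryRaisingRank.exists_raise_rank_gt_of_finrank_eq_succ_of_smul hbr hirr hΘ hΘΘ hP hQ hB' hΘB' hB'Θ
        (by omega) (by rw [hr7, hP8]) (by omega) (fun ρ hρ1 hρr => ?_) hadd hsmul hsymm hPQ hdefP hdefQ hadj
      rw [hr7] at hρr ⊢
      interval_cases ρ <;> omega
    by_cases hodd : Odd (Module.finrank ℂ (LinearMap.range B'))
    · -- ranks `3`, `5`: Ψ-core route with the cores `(5 | 3)`, `(3 | 5)`
      refine UnitaryRaisingRank.exists_raise_rank_gt_of_psi_core hbr hirr hΘ hΘΘ hP hQ hB' hΘB' hB'Θ (by omega)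
        (by omega) (by omega) hadd hsymm hPQ hdefP hdefQ hadj fun U 𝔩 ι P' Q' hbr𝔩 hirr𝔩 hι hιι hP' hQ' hfinP' hfinQ'
          hP'Q' hdefP' hdefQ' hadj𝔩 => ?_
      obtain ⟨j, hj⟩ := hodd
      by_cases hr3 : Module.finrank ℂ (LinearMap.range B') = 3
      · exact UnitaryThreeCoprime.eq_top' hbr𝔩 hirr𝔩 hι hιι hP' hQ' (by omega) (by rw [hfinQ', hr3])
          (s := fun x y : U => s (x : W) y) (fun x y z => by simp only [Submodule.coe_add, hadd])
          (fun x y => hsymm x y) hP'Q' hdefP' hdefQ' hadj𝔩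
      · have hr5 : Module.finrank ℂ (LinearMap.range B') = 5 := by omega
        exact UnitaryThreeCoprime.eq_top hbr𝔩 hirr𝔩 hι hιι hP' hQ' (by omega) (by rw [hfinQ', hr5]; omega)
          (s := fun x y : U => s (x : W) y) (fun x y z => by simp only [Submodule.coe_add, hadd])
          (fun x y => hsymm x y) hP'Q' hdefP' hdefQ' hadj𝔩
    · -- ranks `2`, `4`, `6`: Φ-route with the cores `(2 | odd)`, `(4 | odd)`, `(6 | b − 6)`
      have hev : Module.finrank ℂ (LinearMap.range B') = 2 ∨ Module.finrank ℂ (LinearMap.range B') = 4 ∨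
          Module.finrank ℂ (LinearMap.range B') = 6 := by
        rcases Nat.even_or_odd (Module.finrank ℂ (LinearMap.range B')) with ⟨j, hj⟩ | hodd'
        · omega
        · exact absurd hodd' hodd
      refine UnitaryRaisingRank.exists_raise_rank_gt_of_two_le hbr hirr hΘ hΘΘ hP hQ hadd hsymm hPQ hdefP hdefQ
        hadj hB' hΘB' hB'Θ (by omega) (by omega) (by omega) fun U 𝔩 ι P' Q' hbr𝔩 hirr𝔩 hι hιι hP' hQ' hfinP' hfinQ'
          hP'Q' hdefP' hdefQ' hadj𝔩 => ?_
      rcases hev with hr2 | hr4 | hr6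
      · exact UnitaryTwoOdd.eq_top hbr𝔩 hirr𝔩 hι hιι hP' hQ' (by rw [hfinP', hr2]) ⟨k - 1, by omega⟩
          (s := fun x y : U => s (x : W) y) (fun x y z => by simp only [Submodule.coe_add, hadd])
          (fun x y => hsymm x y) hP'Q' hdefP' hdefQ' hadj𝔩
      · exact UnitaryFourOdd.eq_top hbr𝔩 hirr𝔩 hι hιι hP' hQ' (by rw [hfinP', hr4]) ⟨k - 2, by omega⟩
          (s := fun x y : U => s (x : W) y) (fun x y z => by simp only [Submodule.coe_add, hadd])
          (fun x y => hsymm x y) hP'Q' hdefP' hdefQ' hadj𝔩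
      · exact UnitarySix.eq_top_of_smul hbr𝔩 hirr𝔩 hι hιι hP' hQ' (by rw [hfinP', hr6]) ⟨k - 3, by omega⟩ (by omega)
          (s := fun x y : U => s (x : W) y) (fun x y z => by simp only [Submodule.coe_add, hadd])
          (fun c x y => by simp only [Submodule.coe_smul, hsmul]) (fun x y => hsymm x y) hP'Q' hdefP' hdefQ' hadj𝔩
  obtain ⟨B₂, hB₂, hΘB₂, hB₂Θ, hrk₂⟩ :=
    UnitaryThreeCoprime.exists_raise_rank_ge_two hbr hirr hΘ hΘΘ hP hQ (by omega) (by omega)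
  have h₂ := hle B₂ hΘB₂
  by_cases h8 : 8 ≤ Module.finrank ℂ (LinearMap.range B₂)
  · exact ⟨B₂, hB₂, hΘB₂, hB₂Θ, honto B₂ hΘB₂ h8⟩
  obtain ⟨B₃, hB₃, hΘB₃, hB₃Θ, hrk₃⟩ := hup B₂ hB₂ hΘB₂ hB₂Θ hrk₂ (by omega)
  have h₃ := hle B₃ hΘB₃
  by_cases h8' : 8 ≤ Module.finrank ℂ (LinearMap.range B₃)
  · exact ⟨B₃, hB₃, hΘB₃, hB₃Θ, honto B₃ hΘB₃ h8'⟩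
  obtain ⟨B₄, hB₄, hΘB₄, hB₄Θ, hrk₄⟩ := hup B₃ hB₃ hΘB₃ hB₃Θ (by omega) (by omega)
  have h₄ := hle B₄ hΘB₄
  by_cases h8'' : 8 ≤ Module.finrank ℂ (LinearMap.range B₄)
  · exact ⟨B₄, hB₄, hΘB₄, hB₄Θ, honto B₄ hΘB₄ h8''⟩
  obtain ⟨B₅, hB₅, hΘB₅, hB₅Θ, hrk₅⟩ := hup B₄ hB₄ hΘB₄ hB₄Θ (by omega) (by omega)
  have h₅ := hle B₅ hΘB₅
  by_cases h8''' : 8 ≤ Module.finrank ℂ (LinearMap.range B₅)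
  · exact ⟨B₅, hB₅, hΘB₅, hB₅Θ, honto B₅ hΘB₅ h8'''⟩
  obtain ⟨B₆, hB₆, hΘB₆, hB₆Θ, hrk₆⟩ := hup B₅ hB₅ hΘB₅ hB₅Θ (by omega) (by omega)
  have h₆ := hle B₆ hΘB₆
  by_cases h8'''' : 8 ≤ Module.finrank ℂ (LinearMap.range B₆)
  · exact ⟨B₆, hB₆, hΘB₆, hB₆Θ, honto B₆ hΘB₆ h8''''⟩
  obtain ⟨B₇, hB₇, hΘB₇, hB₇Θ, hrk₇⟩ := hup B₆ hB₆ hΘB₆ hB₆Θ (by omega) (by omega)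
  have h₇ := hle B₇ hΘB₇
  by_cases h8''''' : 8 ≤ Module.finrank ℂ (LinearMap.range B₇)
  · exact ⟨B₇, hB₇, hΘB₇, hB₇Θ, honto B₇ hΘB₇ h8'''''⟩
  obtain ⟨B₈, hB₈, hΘB₈, hB₈Θ, hrk₈⟩ := hup B₇ hB₇ hΘB₇ hB₇Θ (by omega) (by omega)
  have h₈ := hle B₈ hΘB₈
  exact ⟨B₈, hB₈, hΘB₈, hB₈Θ, honto B₈ hΘB₈ (by omega)⟩

end RankEight

/-! ### §2 The `(8 | b)` core for `b ∈ {1, 3, 5, 7, 11, 13, 19}` -/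

section MainEight

variable {W : Type*} [AddCommGroup W] [Module ℂ W]

/-- **THE `Θ`-SUBALGEBRA THEOREM FOR UNITARY MULTIPLICITIES `(8, b)`, `b` ODD, `b ≤ 13`, `b ≠ 9`** (Ribet's Thm. 3 at
`(8, n″)`, `n″ ∈ {1, 3, 5, 7, 11, 13}`, classification-free; NEW: `(8, 11)` — nineteenfolds — and `(8, 13)`). Bases
`b = 1, 3, 5, 7` by the mirrored cores `(1 | ·)`, `(3 | ·)`, `(5 | ·)`, `(7 | ·)`; `b = 11, 13` by one Euclid step onto
`(8 | 3)`, `(8 | 5)`. [cite: Ribet1983, Thm. 3] [cite: Gordon1997, Thm. 6.3 (3) and pp. 18–19]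
[cite: Deligne1982HodgeCycles, I §3 Prop. 3.4, 3.6] -/
theorem UnitaryEight.eq_top_of_smul [FiniteDimensional ℂ W] {𝔊 : Submodule ℂ (Module.End ℂ W)}
    (hbr : ∀ Y ∈ 𝔊, ∀ Z ∈ 𝔊, Y * Z - Z * Y ∈ 𝔊)
    (hirr : ∀ U : Submodule ℂ W, (∀ A ∈ 𝔊, ∀ u ∈ U, A u ∈ U) → U = ⊥ ∨ U = ⊤)
    {Θ : Module.End ℂ W} (hΘ : Θ ∈ 𝔊) (hΘΘ : Θ * Θ = 1)
    {P Q : Submodule ℂ W} (hP : ∀ x, x ∈ P ↔ Θ x = x) (hQ : ∀ x, x ∈ Q ↔ Θ x = -x)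
    (hP8 : Module.finrank ℂ P = 8) (hQodd : Odd (Module.finrank ℂ Q)) (hQ9 : Module.finrank ℂ Q ≠ 9)
    (hQ13 : Module.finrank ℂ Q ≤ 13)
    {s : W → W → ℂ} (hadd : ∀ x y z, s (x + y) z = s x z + s y z)
    (hsmul : ∀ (c : ℂ) (x y : W), s (c • x) y = c * s x y) (hsymm : ∀ x y, s y x = starRingEnd ℂ (s x y))
    (hPQ : ∀ p ∈ P, ∀ q ∈ Q, s p q = 0) (hdefP : ∀ p ∈ P, s p p = 0 → p = 0) (hdefQ : ∀ q ∈ Q, s q q = 0 → q = 0)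
    (hadj : ∀ X ∈ 𝔊, ∃ Y ∈ 𝔊, ∀ x y, s (X x) y = s x (Y y)) : 𝔊 = ⊤ := by
  obtain ⟨k, hk⟩ := hQodd
  by_cases hb1 : Module.finrank ℂ Q = 1
  · exact UnitaryThreeCoprime.eq_top_of_finrank_eq_one hbr hirr hΘ hΘΘ hP hQ (by omega) hb1
  by_cases hb3 : Module.finrank ℂ Q = 3
  · exact UnitaryThreeCoprime.eq_top' hbr hirr hΘ hΘΘ hP hQ (by rw [hP8]; decide) hb3 hadd hsymm hPQ hdefP hdefQ hadj
  by_cases hb5 : Module.finrank ℂ Q = 5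
  · exact UnitaryFive.eq_top_of_smul' hbr hirr hΘ hΘΘ hP hQ (by rw [hP8]; decide) hb5 hadd hsmul hsymm hPQ hdefP
      hdefQ hadj
  by_cases hb7 : Module.finrank ℂ Q = 7
  · exact UnitarySeven.eq_top_of_smul' hbr hirr hΘ hΘΘ hP hQ (by rw [hP8]; decide) hb7 hadd hsmul hsymm hPQ hdefP
      hdefQ hadj
  by_cases hb11 : Module.finrank ℂ Q = 11
  · -- one Euclid step onto `(8 | 3)`
    refine UnitaryCoprimeStep.eq_top_of_onto_of_core hbr hirr hΘ hΘΘ hP hQ hP8 hb11 (by norm_num) (by norm_num) hadd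
      hsymm hPQ hdefP hdefQ hadj ?_ ?_
    · exact UnitaryEight.exists_raise_onto_eight_of_smul hbr hirr hΘ hΘΘ hP hQ hP8 (by omega) ⟨k, hk⟩
        (by omega) hadd hsmul hsymm hPQ hdefP hdefQ hadj
    · intro 𝔩 ι P' Q' hbr𝔩 hirr𝔩 hι hιι hP' hQ' hfinP' hfinQ' hP'Q' hdefP' hdefQ' hadj𝔩
      exact UnitaryThreeCoprime.eq_top' hbr𝔩 hirr𝔩 hι hιι hP' hQ' (by rw [hfinP']; decide) (by omega)
        (s := fun x y : Q => s (x : W) y) (fun x y z => by simp only [Submodule.coe_add, hadd])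
        (fun x y => hsymm x y) hP'Q' hdefP' hdefQ' hadj𝔩
  have hb13 : Module.finrank ℂ Q = 13 := by omega
  -- one Euclid step onto `(8 | 5)`
  refine UnitaryCoprimeStep.eq_top_of_onto_of_core hbr hirr hΘ hΘΘ hP hQ hP8 hb13 (by norm_num) (by norm_num) hadd
    hsymm hPQ hdefP hdefQ hadj ?_ ?_
  · exact UnitaryEight.exists_raise_onto_eight_of_smul hbr hirr hΘ hΘΘ hP hQ hP8 (by omega) ⟨k, hk⟩
      (by omega) hadd hsmul hsymm hPQ hdefP hdefQ hadj
  · intro 𝔩 ι P' Q' hbr𝔩 hirr𝔩 hι hιι hP' hQ' hfinP' hfinQ' hP'Q' hdefP' hdefQ' hadj𝔩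
    exact UnitaryFive.eq_top_of_smul' hbr𝔩 hirr𝔩 hι hιι hP' hQ' (by rw [hfinP']; decide) (by omega)
      (s := fun x y : Q => s (x : W) y) (fun x y z => by simp only [Submodule.coe_add, hadd])
      (fun c x y => by simp only [Submodule.coe_smul, hsmul]) (fun x y => hsymm x y) hP'Q' hdefP' hdefQ' hadj𝔩

/-- **The `(8 | 19)` core** (one Euclid step onto `(8 | 11)`). [cite: Ribet1983, Thm. 3] [cite: Gordon1997, Thm. 6.3 (3)] -/
theorem UnitaryEight.eq_top_of_smul_nineteen [FiniteDimensional ℂ W] {𝔊 : Submodule ℂ (Module.End ℂ W)}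
    (hbr : ∀ Y ∈ 𝔊, ∀ Z ∈ 𝔊, Y * Z - Z * Y ∈ 𝔊)
    (hirr : ∀ U : Submodule ℂ W, (∀ A ∈ 𝔊, ∀ u ∈ U, A u ∈ U) → U = ⊥ ∨ U = ⊤)
    {Θ : Module.End ℂ W} (hΘ : Θ ∈ 𝔊) (hΘΘ : Θ * Θ = 1)
    {P Q : Submodule ℂ W} (hP : ∀ x, x ∈ P ↔ Θ x = x) (hQ : ∀ x, x ∈ Q ↔ Θ x = -x)
    (hP8 : Module.finrank ℂ P = 8) (hQ19 : Module.finrank ℂ Q = 19)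
    {s : W → W → ℂ} (hadd : ∀ x y z, s (x + y) z = s x z + s y z)
    (hsmul : ∀ (c : ℂ) (x y : W), s (c • x) y = c * s x y) (hsymm : ∀ x y, s y x = starRingEnd ℂ (s x y))
    (hPQ : ∀ p ∈ P, ∀ q ∈ Q, s p q = 0) (hdefP : ∀ p ∈ P, s p p = 0 → p = 0) (hdefQ : ∀ q ∈ Q, s q q = 0 → q = 0)
    (hadj : ∀ X ∈ 𝔊, ∃ Y ∈ 𝔊, ∀ x y, s (X x) y = s x (Y y)) : 𝔊 = ⊤ := by
  refine UnitaryCoprimeStep.eq_top_of_onto_of_core hbr hirr hΘ hΘΘ hP hQ hP8 hQ19 (by norm_num) (by norm_num) hadd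
    hsymm hPQ hdefP hdefQ hadj ?_ ?_
  · exact UnitaryEight.exists_raise_onto_eight_of_smul hbr hirr hΘ hΘΘ hP hQ hP8 (by omega) ⟨9, by omega⟩
      (by omega) hadd hsmul hsymm hPQ hdefP hdefQ hadj
  · intro 𝔩 ι P' Q' hbr𝔩 hirr𝔩 hι hιι hP' hQ' hfinP' hfinQ' hP'Q' hdefP' hdefQ' hadj𝔩
    exact UnitaryEight.eq_top_of_smul hbr𝔩 hirr𝔩 hι hιι hP' hQ' hfinP' ⟨5, by omega⟩ (by omega) (by omega)
      (s := fun x y : Q => s (x : W) y) (fun x y z => by simp only [Submodule.coe_add, hadd])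
      (fun c x y => by simp only [Submodule.coe_smul, hsmul]) (fun x y => hsymm x y) hP'Q' hdefP' hdefQ' hadj𝔩

/-- **The mirror `(b | 8)`, `b` odd, `b ≤ 13`, `b ≠ 9`** (apply `eq_top_of_smul` to `−Θ`). [cite: Ribet1983, Thm. 3]
[cite: Gordon1997, Thm. 6.3 (3)] -/
theorem UnitaryEight.eq_top_of_smul' [FiniteDimensional ℂ W] {𝔊 : Submodule ℂ (Module.End ℂ W)}
    (hbr : ∀ Y ∈ 𝔊, ∀ Z ∈ 𝔊, Y * Z - Z * Y ∈ 𝔊)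
    (hirr : ∀ U : Submodule ℂ W, (∀ A ∈ 𝔊, ∀ u ∈ U, A u ∈ U) → U = ⊥ ∨ U = ⊤)
    {Θ : Module.End ℂ W} (hΘ : Θ ∈ 𝔊) (hΘΘ : Θ * Θ = 1)
    {P Q : Submodule ℂ W} (hP : ∀ x, x ∈ P ↔ Θ x = x) (hQ : ∀ x, x ∈ Q ↔ Θ x = -x)
    (hPodd : Odd (Module.finrank ℂ P)) (hP9 : Module.finrank ℂ P ≠ 9) (hP13 : Module.finrank ℂ P ≤ 13)
    (hQ8 : Module.finrank ℂ Q = 8)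
    {s : W → W → ℂ} (hadd : ∀ x y z, s (x + y) z = s x z + s y z)
    (hsmul : ∀ (c : ℂ) (x y : W), s (c • x) y = c * s x y) (hsymm : ∀ x y, s y x = starRingEnd ℂ (s x y))
    (hPQ : ∀ p ∈ P, ∀ q ∈ Q, s p q = 0) (hdefP : ∀ p ∈ P, s p p = 0 → p = 0) (hdefQ : ∀ q ∈ Q, s q q = 0 → q = 0)
    (hadj : ∀ X ∈ 𝔊, ∃ Y ∈ 𝔊, ∀ x y, s (X x) y = s x (Y y)) : 𝔊 = ⊤ := by
  have hnΘ : -Θ ∈ 𝔊 := Submodule.neg_mem _ hΘ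
  have hnΘΘ : (-Θ) * (-Θ) = 1 := by rw [neg_mul_neg, hΘΘ]
  exact UnitaryEight.eq_top_of_smul hbr hirr hnΘ hnΘΘ (P := Q) (Q := P)
    (fun x => by rw [hQ, LinearMap.neg_apply, neg_eq_iff_eq_neg]) (fun x => by rw [hP, LinearMap.neg_apply, neg_inj])
    hQ8 hPodd hP9 hP13 hadd hsmul hsymm (fun q hq p hp => by rw [hsymm, hPQ p hp q hq, map_zero]) hdefQ hdefP hadj

/-- **The mirror `(19 | 8)`.** [cite: Ribet1983, Thm. 3] [cite: Gordon1997, Thm. 6.3 (3)] -/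
theorem UnitaryEight.eq_top_of_smul_nineteen' [FiniteDimensional ℂ W] {𝔊 : Submodule ℂ (Module.End ℂ W)}
    (hbr : ∀ Y ∈ 𝔊, ∀ Z ∈ 𝔊, Y * Z - Z * Y ∈ 𝔊)
    (hirr : ∀ U : Submodule ℂ W, (∀ A ∈ 𝔊, ∀ u ∈ U, A u ∈ U) → U = ⊥ ∨ U = ⊤)
    {Θ : Module.End ℂ W} (hΘ : Θ ∈ 𝔊) (hΘΘ : Θ * Θ = 1)
    {P Q : Submodule ℂ W} (hP : ∀ x, x ∈ P ↔ Θ x = x) (hQ : ∀ x, x ∈ Q ↔ Θ x = -x)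
    (hP19 : Module.finrank ℂ P = 19) (hQ8 : Module.finrank ℂ Q = 8)
    {s : W → W → ℂ} (hadd : ∀ x y z, s (x + y) z = s x z + s y z)
    (hsmul : ∀ (c : ℂ) (x y : W), s (c • x) y = c * s x y) (hsymm : ∀ x y, s y x = starRingEnd ℂ (s x y))
    (hPQ : ∀ p ∈ P, ∀ q ∈ Q, s p q = 0) (hdefP : ∀ p ∈ P, s p p = 0 → p = 0) (hdefQ : ∀ q ∈ Q, s q q = 0 → q = 0)
    (hadj : ∀ X ∈ 𝔊, ∃ Y ∈ 𝔊, ∀ x y, s (X x) y = s x (Y y)) : 𝔊 = ⊤ := by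
  have hnΘ : -Θ ∈ 𝔊 := Submodule.neg_mem _ hΘ
  have hnΘΘ : (-Θ) * (-Θ) = 1 := by rw [neg_mul_neg, hΘΘ]
  exact UnitaryEight.eq_top_of_smul_nineteen hbr hirr hnΘ hnΘΘ (P := Q) (Q := P)
    (fun x => by rw [hQ, LinearMap.neg_apply, neg_eq_iff_eq_neg]) (fun x => by rw [hP, LinearMap.neg_apply, neg_inj])
    hQ8 hP19 hadd hsmul hsymm (fun q hq p hp => by rw [hsymm, hPQ p hp q hq, map_zero]) hdefQ hdefP hadj

end MainEight

end HodgeStructure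

end Literature.AlgebraicGeometry.Motives

end
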